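import Summits.ValiantsHypothesis.ValiantsHypothesis.Theses.BarrierLever
import Literature.Barriers.ValiantsHypothesis.GKSS17FSVPresentation

/-!
# Route BarrierLever — item 19793 `GeneratorSeedDegreeBound` (coefficient axis of the V4 door)

Item `stmt-ValiantsHypothesis-19793` (support, rank 9; planner p2-g7, cell valiant-natproofs, rung V4;
bears_on crux stmt-ValiantsHypothesis-14610 = FSV Question 6 — it neither restates nor weakens the
crux; unconditional). SEED-DEGREE LOWER BOUND FOR GENERATORS: let
`G ∈ (ℂ[y₁, …, y_q])[x₁, …, x_n]` be a polynomial family («generator») whose coefficients are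
polynomials in the seeds `y` of total degree `≤ d`, and suppose every monomial `x^m` with
`deg m ≤ n` is `G(y)` for some `y ∈ ℂ^q`. Then `C(2n, n) ≤ C(q + d, d)`.

**Proof** (planner p2-g7's, re-derived here because the attached scratch `CoeffAxis3-p2g7.lean` is
not readable from a prover jail; the only tree ingredient is the monomial count
`GKSS2017.ncard_degLE`): write `G = ∑_{|α| ≤ d} y^α G_α`. The matrix
`M[m, α] := [y^α x^m] G` (rows: monomials `m` of degree `≤ n` in `n` variables, columns: seed
monomials `α` of degree `≤ d` in `q` variables) has a SURJECTIVE column map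
`u ↦ M u : ℂ^{C(q+d,d)} → ℂ^{C(2n,n)}`: for the row index `m₀`, the hypothesis gives a seed `y` with
`G(y) = x^{m₀}`, and the vector `u := (y^α)_α` is mapped to
`(m ↦ ∑_α [y^α x^m]G · y^α) = (m ↦ ([x^m]G)(y)) = (m ↦ [x^m] G(y)) = e_{m₀}`. Hence
`C(2n,n) = finrank ℂ^{rows} ≤ finrank ℂ^{columns} = C(q+d,d)`
(`LinearMap.finrank_le_finrank_of_surjective`).

READING (planner): every transfer theorem on the coefficient axis (FSV Lemma 14 style; items
20029/20033/20037) interpolates `D ∘ G` on an integer seed grid of side `> N^a · d` and lands in the box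
of magnitude `≈ (M·N^a)^d`; this item shows `d ≥ (2n − log₂(2n+1)) / log₂(q+d)` for ANY onto generator
with `q` seeds, so with `q = poly(n)` seeds `d = Ω(n / log n)` and generator-based grid transfer cannot
bring the upper end of the coefficient-axis window below `t ≈ a·n/log n`.

WHAT THIS IS NOT: nothing on FSV Question 6 / crux stmt-ValiantsHypothesis-14610 or on VP vs VNP
(VP ≠ VNP is NOT proved); a ceiling for generator + grid-interpolation transfer arguments only.
-/

-- layout Summits/ValiantsHypothesis/ValiantsHypothesis forces the duplicated namespace component
set_option linter.dupNamespace false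

namespace Summit.ValiantsHypothesis.ValiantsHypothesis.Theorems.BarrierLever.CoeffAxis

open MvPolynomial

/-- Evaluation of a polynomial as a sum over any finite set of exponents containing its support
(Mathlib's `eval_eq'` sums over the support itself). -/
theorem eval_eq_sum_of_support_subset {σ R : Type*} [CommSemiring R] [Fintype σ]
    (p : MvPolynomial σ R) (x : σ → R) {A : Finset (σ →₀ ℕ)} (hA : p.support ⊆ A) :
    eval x p = ∑ α ∈ A, coeff α p * ∏ i, x i ^ α i := by
  rw [eval_eq']
  refine Finset.sum_subset hA (fun α _ hα => ?_)
  rw [notMem_support_iff.1 hα, zero_mul]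

/-- The support of a polynomial of total degree `≤ d` consists of exponents of degree `≤ d`. -/
theorem degree_le_of_mem_support {σ R : Type*} [CommSemiring R] {p : MvPolynomial σ R} {d : ℕ}
    (hp : p.totalDegree ≤ d) {α : σ →₀ ℕ} (hα : α ∈ p.support) : α.degree ≤ d := by
  rw [Finsupp.degree_apply]
  exact (le_totalDegree hα).trans hp

/-- **Seed-degree lower bound** (the working form of item 19793): if the coefficients of
`G ∈ (ℂ[y₁..y_q])[x₁..x_n]` have total degree `≤ d` in the seeds and every monomial `x^m`,
`deg m ≤ n`, is a specialisation `G(y)`, then `C(2n, n) ≤ C(q + d, d)`. -/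
theorem choose_le_choose_of_onto_generator (n q d : ℕ)
    (G : MvPolynomial (Fin n) (MvPolynomial (Fin q) ℂ))
    (hdeg : ∀ m : Fin n →₀ ℕ, (coeff m G).totalDegree ≤ d)
    (honto : ∀ m : Fin n →₀ ℕ, m.degree ≤ n →
      ∃ y : Fin q → ℂ, map (eval y) G = monomial m 1) :
    (2 * n).choose n ≤ (q + d).choose d := by
  classical
  -- the two finite index sets: monomials of degree ≤ n in n variables, seed monomials of degree ≤ d
  have hSfin : {m : Fin n →₀ ℕ | m.degree ≤ n}.Finite := Finsupp.finite_of_degree_le n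
  have hTfin : {α : Fin q →₀ ℕ | α.degree ≤ d}.Finite := Finsupp.finite_of_degree_le d
  set S : Finset (Fin n →₀ ℕ) := hSfin.toFinset with hSdef
  set T : Finset (Fin q →₀ ℕ) := hTfin.toFinset with hTdef
  have hmemS : ∀ m : Fin n →₀ ℕ, m ∈ S ↔ m.degree ≤ n := fun m => by
    rw [hSdef, Set.Finite.mem_toFinset]; rfl
  have hmemT : ∀ α : Fin q →₀ ℕ, α ∈ T ↔ α.degree ≤ d := fun α => by
    rw [hTdef, Set.Finite.mem_toFinset]; rfl
  have hScard : S.card = (2 * n).choose n := by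
    rw [hSdef, ← Nat.card_eq_card_finite_toFinset hSfin, two_mul]
    exact Literature.Barriers.ValiantsHypothesis.GKSS2017.ncard_degLE n n
  have hTcard : T.card = (q + d).choose d := by
    rw [hTdef, ← Nat.card_eq_card_finite_toFinset hTfin]
    exact Literature.Barriers.ValiantsHypothesis.GKSS2017.ncard_degLE q d
  -- the coefficient matrix `M[m, α] = [y^α x^m] G`
  let M : Matrix S T ℂ := fun m α => coeff (α : Fin q →₀ ℕ) (coeff (m : Fin n →₀ ℕ) G)
  -- its column map hits every standard basis vector
  have hbasis : ∀ m₀ : S, ∃ u : T → ℂ, M.mulVec u = Pi.single m₀ 1 := by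
    intro m₀
    obtain ⟨y, hy⟩ := honto (m₀ : Fin n →₀ ℕ) ((hmemS _).1 m₀.2)
    refine ⟨fun α => ∏ i, y i ^ (α : Fin q →₀ ℕ) i, ?_⟩
    funext m
    have hsupp : (coeff (m : Fin n →₀ ℕ) G).support ⊆ T := fun α hα =>
      (hmemT α).2 (degree_le_of_mem_support (hdeg _) hα)
    have h1 : M.mulVec (fun α => ∏ i, y i ^ (α : Fin q →₀ ℕ) i) m
        = eval y (coeff (m : Fin n →₀ ℕ) G) := by
      rw [eval_eq_sum_of_support_subset _ y hsupp, ← Finset.sum_coe_sort T]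
      rfl
    rw [h1, ← coeff_map, hy, coeff_monomial, Pi.single_apply]
    by_cases h : m = m₀
    · subst h; simp
    · have h' : ¬ ((m₀ : Fin n →₀ ℕ) = (m : Fin n →₀ ℕ)) := fun hc => h (Subtype.ext hc.symm)
      rw [if_neg h', if_neg h]
  have hsurj : Function.Surjective M.mulVecLin := by
    rw [← LinearMap.range_eq_top, eq_top_iff, ← (Pi.basisFun ℂ S).span_eq, Submodule.span_le]
    rintro _ ⟨m₀, rfl⟩
    obtain ⟨u, hu⟩ := hbasis m₀
    exact ⟨u, by rw [Matrix.mulVecLin_apply, hu, Pi.basisFun_apply]⟩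
  have hrank := LinearMap.finrank_le_finrank_of_surjective hsurj
  rw [Module.finrank_fintype_fun_eq_card, Module.finrank_fintype_fun_eq_card, Fintype.card_coe,
    Fintype.card_coe, hScard, hTcard] at hrank
  exact hrank

/-- **Item 19793 `GeneratorSeedDegreeBound`** (the route decl, by name). -/
theorem generatorSeedDegreeBound : Theses.BarrierLever.GeneratorSeedDegreeBound := by
  intro n q d G hdeg honto
  exact choose_le_choose_of_onto_generator n q d G hdeg honto

end Summit.ValiantsHypothesis.ValiantsHypothesis.Theorems.BarrierLever.CoeffAxis
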